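import Summits.ResolutionOfSingularities.ResolutionOfSingularities.Theorems.WeightedInvariantKeyRungThreeOfDropB3
import Summits.ResolutionOfSingularities.ResolutionOfSingularities.Theorems.WeightedInvariantP3aTieFreeDrop
import HarnessLib

/-!
# (D-b³-curve) REDUCED TO AN `S`-SIDE DATUM: at a curve centre with an rsp-adapted, tie-free transversal AQS datum presenting `J₃ᵗ`,
# `ι₃ᵗ` drops at every successor over the closed point, for EVERY presentation of the filtration
# (door `HypersurfaceCentreConstruction`, stmt-ResolutionOfSingularities-19897; gap list `keyRungGrHomLE_three_of_tieDescent_dropb3`)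

Helper for `stub_keyRungGrHomLE_three` (def-free, `--supports 19897`).  Sequel of …KeyRungThreeOfDropB3 ((DROP)₃ = TYPE (a) ✓ + (D-div) ✓ + (D-b³),
(D-b³) = curve centres + point centres of threefolds).  The tree's CURVE° type (b) theorem
`LocalGameEFTCylinder.iotaOrd_transform_lt_of_tieFree_typeB` (…P3aTieFreeDrop: order drop at every successor over the special point of the
cylinder move `((y, x); (r, q))` at a TIE-FREE position with an rsp-adapted transversal Abramovich–Quek–Schober datum) is turned into the
(D-b³) currency: **`Iota3.dropb_curve_of_tieFree_datum`** — for EVERY family `(u, w)` whose weighted pieces are those of `((y, x); (r, q))`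
(all presentations of one filtration have literally the same cobordant algebra), at every successor prime `𝔫` of `cobordantAlgebra' u w` over
the closed point (`t⁻¹ ∈ 𝔫`, `𝔪_S ≤ 𝔫 ∩ S`, off the vertex, `f = (t⁻¹)ᵃ g`, `t⁻¹ ∤ g`, `g/1 ∈ 𝔪_𝔫²`): `iotaFlatT (B_𝔫) (g/1) < iotaFlatT S f`
(`t`-homogeneity is not even needed; order drop ⇒ `ι₃ᵗ` drop by `Iota3.iotaFlatT_lt_of_iotaOrd_lt`).
So the curve part of (D-b³) is reduced to the `S`-SIDE statement (no cobordant algebra): «at the canonical curve centre `P` (`ht P = 2`) of a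
three-dimensional door position there is a regular system of parameters `(y, x, z)` with `P = (y, x)`, coprime weights `0 < q ≤ r` and `ν ≥ 1` with
`f ∈ 𝒥_{rν}((y,x);(r,q)) ∩ 𝔪^ν ∖ 𝔪^{ν+1}`, the tie-freeness `f ∉ 𝒥_{(r+1)ν}((x, y − λx^r, z); (q, r+1, 1))` (all `λ`) and (`q = r`)
`f ∉ 𝒥_{2ν}((y,x,z);(1,2,1))`, and `jFlatT S f = 𝒥((y,x);(r,q))`» [M–L: adapted AQS datum — cf. `Iota3.exists_rsp_adapted`,
`exists_adapted_admissible` (tie case); `¬ IsTiePosition` at a curve centre; the identification of `J₃ᵗ` with the contracted transversal lex-max filtration].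
[OURS · L1 W4.3 · audit glue; AI work, weaker than expert review; nothing here is a statement of the manuscript under review.]

## References

* D. Abramovich, M. H. Quek, B. Schober, weighted blow-ups of curve singularities on surfaces in arbitrary characteristic (2025), Thm 1.3 (3).
  [AbramovichQuekSchober2025]
* J. Włodarczyk, *Functorial resolution by torus actions*, arXiv:2203.03090, Def. 2.3.5. [Wlodarczyk2022]
-/

noncomputable section

set_option linter.dupNamespace false -- mandated namespace of this single-conjunct summit

open IsLocalRing Literature.AlgebraicGeometry.Resolution
open Summit.ResolutionOfSingularities.ResolutionOfSingularities.Theorems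
open Summit.ResolutionOfSingularities.ResolutionOfSingularities.Theorems.ContactCylinder

namespace Summit.ResolutionOfSingularities.ResolutionOfSingularities.Cruxes.HypersurfaceCentreConstruction.LocalEngine

namespace Iota3

/-- Carrier transport: the type (b) order drop of …P3aTieFreeDrop on the extended Rees algebra of ANY filtration `I` EQUAL to
`𝒥((y,x);(r,q))` (by `subst`), in the `ι₃ᵗ` currency. [OURS · L1 W4.3 · seam] -/
theorem dropb_curve_of_tieFree_datum_aux {S : Type} [CommRing S] [IsRegularLocalRing S] {y x z : S} {q r ν : ℕ} {f : S}
    (hyxz : Ideal.span (Set.range ![y, x, z]) = maximalIdeal S) (hd : (maximalIdeal S).spanFinrank = 3)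
    [hP : (Ideal.span (Set.range ![y, x])).IsPrime] (hq : 0 < q) (hqr : q ≤ r) (hcop : Nat.Coprime r q) (hν : 1 ≤ ν)
    (hfν0 : f ∈ maximalIdeal S ^ ν) (hfν : f ∉ maximalIdeal S ^ (ν + 1))
    (hadm : f ∈ weightedMonomialIdeal ![y, x] ![r, q] (r * ν))
    (htie : ∀ lam : S, f ∉ weightedMonomialIdeal ![x, y - lam * x ^ r, z] ![q, r + 1, 1] ((r + 1) * ν))
    (htie' : q = r → f ∉ weightedMonomialIdeal ![y, x, z] ![1, 2, 1] (2 * ν))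
    {I : ℕ → Ideal S} (hI : I = weightedMonomialIdeal ![y, x] ![r, q]) (P : Ideal S) :
    ∀ (𝔫 : Ideal (extReesAlgebra I)) [𝔫.IsPrime], extReesAlgebra.tInv I ∈ 𝔫 →
      P.map (algebraMap S (extReesAlgebra I)) ≤ 𝔫 →
      ¬ extReesAlgebra.vertexIdeal I ≤ 𝔫 →
      maximalIdeal S ≤ 𝔫.comap (algebraMap S (extReesAlgebra I)) →
      ∀ (a : ℕ) (g : extReesAlgebra I),
        algebraMap S (extReesAlgebra I) f = extReesAlgebra.tInv I ^ a * g →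
        ¬ extReesAlgebra.tInv I ∣ g →
        algebraMap (extReesAlgebra I) (Localization.AtPrime 𝔫) g ∈ maximalIdeal (Localization.AtPrime 𝔫) ^ 2 →
        iotaFlatT (Localization.AtPrime 𝔫) (algebraMap (extReesAlgebra I) (Localization.AtPrime 𝔫) g) < iotaFlatT S f := by
  subst hI
  have hν' : (ν : Ordinal.{0}) ≤ iotaOrd S f := (natCast_le_iotaOrd_iff S f ν).mpr hfν0
  intro 𝔫 _ hT hP𝔫 hV hM a g hfg hTg hg2
  exact iotaFlatT_lt_of_iotaOrd_lt _ _ _ _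
    (lt_of_lt_of_le (LocalGameEFTCylinder.iotaOrd_transform_lt_of_tieFree_typeB hyxz hd hq hqr hcop hν hfν hadm htie htie' P
      𝔫 hT hP𝔫 hV hM a g hfg hTg hg2) hν')

/-- **(D-b³-curve) FROM A TIE-FREE rsp-ADAPTED TRANSVERSAL DATUM.**  `S` regular local with regular system of parameters `(y, x, z)`
(`spanFinrank 𝔪 = 3`), `(y, x)` prime, coprime weights `0 < q ≤ r`, `ν ≥ 1`, `f ∈ 𝒥_{rν}((y,x);(r,q))`, `f ∈ 𝔪^ν ∖ 𝔪^{ν+1}`, tie-free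
(`f ∉ 𝒥_{(r+1)ν}((x, y − λx^r, z); (q, r+1, 1))` for all `λ`, and `f ∉ 𝒥_{2ν}((y,x,z);(1,2,1))` if `q = r`); `(u, w)` ANY family with
`weightedMonomialIdeal u w m = 𝒥ₘ((y,x);(r,q))` for all `m`.  Then at every successor prime `𝔫` of `cobordantAlgebra' u w` over the closed point
(`t⁻¹ ∈ 𝔫`, `𝔪_S ≤ 𝔫 ∩ S`, `𝔫 ⊉` vertex) and every `f = (t⁻¹)ᵃ g`, `t⁻¹ ∤ g`, `g/1 ∈ 𝔪_𝔫²`: `iotaFlatT (B_𝔫) (g/1) < iotaFlatT S f`.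
(`LocalGameEFTCylinder.iotaOrd_transform_lt_of_tieFree_typeB` + `ν ≤ ord_S f` + `iotaFlatT_lt_of_iotaOrd_lt`, transported along the equality of
filtrations.) [OURS · L1 W4.3 · (D-b³-curve) ⟸ S-side datum] [cite: AbramovichQuekSchober2025, Thm 1.3 (3)] -/
theorem dropb_curve_of_tieFree_datum {S : Type} [CommRing S] [IsRegularLocalRing S] {y x z : S} {q r ν : ℕ} {f : S}
    (hyxz : Ideal.span (Set.range ![y, x, z]) = maximalIdeal S) (hd : (maximalIdeal S).spanFinrank = 3)
    [hP : (Ideal.span (Set.range ![y, x])).IsPrime] (hq : 0 < q) (hqr : q ≤ r) (hcop : Nat.Coprime r q) (hν : 1 ≤ ν)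
    (hfν0 : f ∈ maximalIdeal S ^ ν) (hfν : f ∉ maximalIdeal S ^ (ν + 1))
    (hadm : f ∈ weightedMonomialIdeal ![y, x] ![r, q] (r * ν))
    (htie : ∀ lam : S, f ∉ weightedMonomialIdeal ![x, y - lam * x ^ r, z] ![q, r + 1, 1] ((r + 1) * ν))
    (htie' : q = r → f ∉ weightedMonomialIdeal ![y, x, z] ![1, 2, 1] (2 * ν))
    {n : ℕ} (u : Fin n → S) (w : Fin n → ℕ) (hpres : ∀ m : ℕ, weightedMonomialIdeal u w m = weightedMonomialIdeal ![y, x] ![r, q] m)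
    (P : Ideal S) :
    ∀ (𝔫 : Ideal (cobordantAlgebra' u w)) [𝔫.IsPrime], cobordantT' u w ∈ 𝔫 →
      P.map (algebraMap S (cobordantAlgebra' u w)) ≤ 𝔫 →
      ¬ extReesAlgebra.vertexIdeal (weightedMonomialIdeal u w) ≤ 𝔫 →
      maximalIdeal S ≤ 𝔫.comap (algebraMap S (cobordantAlgebra' u w)) →
      ∀ (a : ℕ) (g : cobordantAlgebra' u w),
        algebraMap S (cobordantAlgebra' u w) f = cobordantT' u w ^ a * g →
        ¬ cobordantT' u w ∣ g →
        algebraMap (cobordantAlgebra' u w) (Localization.AtPrime 𝔫) g ∈ maximalIdeal (Localization.AtPrime 𝔫) ^ 2 →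
        iotaFlatT (Localization.AtPrime 𝔫) (algebraMap (cobordantAlgebra' u w) (Localization.AtPrime 𝔫) g) < iotaFlatT S f := by
  exact dropb_curve_of_tieFree_datum_aux hyxz hd hq hqr hcop hν hfν0 hfν hadm htie htie' (funext hpres) P

/-- **The same in the binder shape of (D-b³)** (`𝔪_S · B ≤ 𝔫` instead of `𝔪_S ≤ 𝔫 ∩ S`; the `t`-homogeneity hypothesis is not used).
[OURS · L1 W4.3 · (D-b³-curve) ⟸ S-side datum] -/
theorem dropb3_curve_of_tieFree_datum {S : Type} [CommRing S] [IsRegularLocalRing S] {y x z : S} {q r ν : ℕ} {f : S}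
    (hyxz : Ideal.span (Set.range ![y, x, z]) = maximalIdeal S) (hd : (maximalIdeal S).spanFinrank = 3)
    [hP : (Ideal.span (Set.range ![y, x])).IsPrime] (hq : 0 < q) (hqr : q ≤ r) (hcop : Nat.Coprime r q) (hν : 1 ≤ ν)
    (hfν0 : f ∈ maximalIdeal S ^ ν) (hfν : f ∉ maximalIdeal S ^ (ν + 1))
    (hadm : f ∈ weightedMonomialIdeal ![y, x] ![r, q] (r * ν))
    (htie : ∀ lam : S, f ∉ weightedMonomialIdeal ![x, y - lam * x ^ r, z] ![q, r + 1, 1] ((r + 1) * ν))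
    (htie' : q = r → f ∉ weightedMonomialIdeal ![y, x, z] ![1, 2, 1] (2 * ν))
    {n : ℕ} (u : Fin n → S) (w : Fin n → ℕ) (hpres : ∀ m : ℕ, weightedMonomialIdeal u w m = weightedMonomialIdeal ![y, x] ![r, q] m) :
    ∀ (𝔫 : Ideal (cobordantAlgebra' u w)) [𝔫.IsPrime], IsTHomogeneous u w 𝔫 → cobordantT' u w ∈ 𝔫 →
      (maximalIdeal S).map (algebraMap S (cobordantAlgebra' u w)) ≤ 𝔫 →
      ¬ extReesAlgebra.vertexIdeal (weightedMonomialIdeal u w) ≤ 𝔫 →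
      ∀ (a : ℕ) (g : cobordantAlgebra' u w), algebraMap S (cobordantAlgebra' u w) f = cobordantT' u w ^ a * g →
        ¬ cobordantT' u w ∣ g →
        algebraMap (cobordantAlgebra' u w) (Localization.AtPrime 𝔫) g ∈ maximalIdeal (Localization.AtPrime 𝔫) ^ 2 →
        iotaFlatT (Localization.AtPrime 𝔫) (algebraMap (cobordantAlgebra' u w) (Localization.AtPrime 𝔫) g) < iotaFlatT S f := by
  intro 𝔫 _ _ hT hM hV a g hfg hTg hg2
  exact dropb_curve_of_tieFree_datum hyxz hd hq hqr hcop hν hfν0 hfν hadm htie htie' u w hpres (maximalIdeal S) 𝔫 hT hM hV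
    (Ideal.map_le_iff_le_comap.mp hM) a g hfg hTg hg2

end Iota3

end Summit.ResolutionOfSingularities.ResolutionOfSingularities.Cruxes.HypersurfaceCentreConstruction.LocalEngine

end
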